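import Mathlib
import Summits.Ventures.PercRepro2.Defs
import Summits.Ventures.PercRepro2.Graph
import Summits.Ventures.PercRepro2.OneColourSwitch
import Summits.Ventures.PercRepro2.RegionHubSign
import Summits.Ventures.PercRepro2.SideSwitch
import Summits.Ventures.PercRepro2.M9NoPocketDefs
import Summits.Ventures.PercRepro2.M9NoPocketWorldD
import Summits.Ventures.PercRepro2.M9SubcubeHarris
import Summits.Ventures.PercRepro2.M9ClusterFibreHarris
import Summits.Ventures.PercRepro2.M9ClusterAvoidHarris
import Summits.Ventures.PercRepro2.M9PocketUnitFibre

/-!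
# The `K`-only points without a `W`-side, summed fibre by fibre (blind cell PercRepro2,
p3 g39, 2026-08-29; `proofs/P3-POCKETRK.md` §3, §5‴ (c) and §9 K5, part 2)

The colourings with no `W`-side vertex in `G − d` (`∀ x ∈ M₂(G − d), x = r ∨ x = s`), no edge
inside `{r, s}` and no `T`-edge are partitioned into the exploration fibres of
`M9PocketUnitFibre`: the fibre of `ω` is the set of colourings agreeing with `ω` on the edges
touching `U(ω) = C_Y(d; ω) ∪ K₂(G − d) ∪ M₂(G − d)`, and on it `U`, the worlds of `{r, s}` in
`G`, `Sep`, `DOne`, the status of `d` and `σ_rs` are constant (`U_eq_on_unitFibre`,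
`mem_M2_iff_on_unitFibre`, `sep2_iff_on_unitFibre`, `sigma_rs_eq_on_unitFibre`; the `W`-cluster
of `r` is `{r}`: `cluster_compl_mark_eq_singleton`).  The representative of a fibre is the
colouring with every free edge `W` (`rep_eq_iff_mem_fibre`), and `Finset.sum_fiberwise_of_maps_to`
splits a sum over the `K`-only points into fibre sums.  With the fibre Harris
`sum_unitFibre_sigma_pq_of_isLowerSet_nonpos` this gives the

**THEOREM** (`sum_konly_noWside_nonpos`): for every predicate `P` constant on the fibres of the
colourings without a `W`-side and every family `A` of lower sets constant on those fibres,
`Σ_{Sep ∧ DOne ∧ d ∈ K₂ ∖ M₂ ∧ no W-side ∧ P ω ∧ ω ∈ A ω} σ_pq · σ_rs ≤ 0`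

— `σ_rs ≥ 0` on these points and each fibre sum is `σ_rs · Σ_{F ∩ A} σ_pq ≤ 0`.  Instances:
`A = univ` and `P = «the edges at d are those of ρ₀ and ω lies in the unit of ρ₀»` is
`S(D) ≤ 0`, every dead configuration of a unit (`proofs/P3-POCKETRK.md` §3); `A ω = the
`W`-defect set of `ω`` is the hub–dead-end part: **`Σ_{HD ∧ d ∈ K₂ ∧ no W-side ∧ P} σ_pq σ_rs ≤ 0`**
(`sum_konly_HD_noWside_nonpos`) — the dirty clean points and the dead configurations of a unit
together (§5‴ (c) + §3: `S_dead + K_dirty ≤ 0`).  Own work; std axioms.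
-/

namespace Summit.Ventures.PercRepro2

namespace NoPocket

open Finset Classical OneColourSwitch SideSwitch

variable {V : Type*} {E : Type*}

section Pointwise

variable {ends : E → Sym2 V} {p q r s d : V} {ω₀ : Config E}

/-- On the fibre of `ω₀` the set `U` is that of `ω₀`. -/
lemma U_eq_on_unitFibre (hdr : d ≠ r) (hds : d ≠ s)
    (hB : ∀ x ∈ M2 (endsD ends d) r s ω₀, x = r ∨ x = s) {ω : Config E}
    (hω : ∀ e ∈ touches ends (cluster ends ω₀ d ∪ K2 (endsD ends d) r s ω₀ ∪
      M2 (endsD ends d) r s ω₀), ω e = ω₀ e) :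
    cluster ends ω d ∪ K2 (endsD ends d) r s ω ∪ M2 (endsD ends d) r s ω =
      cluster ends ω₀ d ∪ K2 (endsD ends d) r s ω₀ ∪ M2 (endsD ends d) r s ω₀ := by
  rw [cluster_d_eq_on_unitFibre hdr hds hB hω, K2_endsD_eq_on_unitFibre hdr hds hω,
    M2_endsD_eq_on_unitFibre hdr hds hω]

/-- Agreement on the edges touching `U(ω₀)` is symmetric: `ω₀` agrees with `ω` on the edges
touching `U(ω)`. -/
lemma eqOn_touches_U_symm (hdr : d ≠ r) (hds : d ≠ s)
    (hB : ∀ x ∈ M2 (endsD ends d) r s ω₀, x = r ∨ x = s) {ω : Config E}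
    (hω : ∀ e ∈ touches ends (cluster ends ω₀ d ∪ K2 (endsD ends d) r s ω₀ ∪
      M2 (endsD ends d) r s ω₀), ω e = ω₀ e) :
    ∀ e ∈ touches ends (cluster ends ω d ∪ K2 (endsD ends d) r s ω ∪
      M2 (endsD ends d) r s ω), ω₀ e = ω e := by
  rw [U_eq_on_unitFibre hdr hds hB hω]
  exact fun e he => (hω e he).symm

/-- **The `W`-cluster of `r` (or `s`) is `{r}` (`{s}`)** on the fibre of a colouring without a
`W`-side, no edge inside `{r, s}` and no `T`-edge: every edge at `r` is open. -/
lemma cluster_compl_mark_eq_singleton (hdr : d ≠ r) (hds : d ≠ s)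
    (hrs : within ends ({r, s} : Set V) = ∅) (hT : ∀ e, ends e ≠ s(d, r) ∧ ends e ≠ s(d, s))
    (hB : ∀ x ∈ M2 (endsD ends d) r s ω₀, x = r ∨ x = s) {ω : Config E}
    (hω : ∀ e ∈ touches ends (cluster ends ω₀ d ∪ K2 (endsD ends d) r s ω₀ ∪
      M2 (endsD ends d) r s ω₀), ω e = ω₀ e) {t : V} (ht : t = r ∨ t = s) :
    cluster ends (OneColourSwitch.compl ω) t = {t} := by
  have htU : t ∈ cluster ends ω₀ d ∪ K2 (endsD ends d) r s ω₀ ∪ M2 (endsD ends d) r s ω₀ := by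
    rcases ht with rfl | rfl
    · exact Or.inl (Or.inr (r_mem_K2 t s ω₀))
    · exact Or.inl (Or.inr (s_mem_K2 r t ω₀))
  have htd : t ≠ d := by
    rcases ht with rfl | rfl
    · exact hdr.symm
    · exact hds.symm
  ext y
  simp only [Set.mem_singleton_iff, mem_cluster]
  constructor
  · intro hy
    have key : y ∈ {z | z = t} := by
      refine mem_of_conn_of_closed (ends := ends) (ω := OneColourSwitch.compl ω) ?_ rfl hy
      rintro a ha b hab
      simp only [Set.mem_setOf_eq] at ha ⊢
      subst ha
      exfalso
      obtain ⟨hne, e, he, hends⟩ := openGraph_adj.1 hab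
      have he₀ : ω₀ e = false := by
        have := hω e (mem_touches_of_ends hends (Or.inl htU))
        simp only [OneColourSwitch.compl, Bool.not_eq_true'] at he
        rw [← this]; exact he
      -- `b ≠ r, s` (no edge inside `{r, s}`), `b ≠ d` (no `T`-edge)
      have hbrs : ¬ (b = r ∨ b = s) := by
        intro hb
        have : e ∈ within ends ({r, s} : Set V) := by
          refine ⟨a, ?_, b, ?_, hends⟩
          · rcases ht with rfl | rfl <;> simp
          · rcases hb with rfl | rfl <;> simp
        rw [hrs] at this
        exact this
      have hbd : b ≠ d := by
        rintro rfl
        rcases ht with rfl | rfl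
        · exact (hT e).1 (by rw [hends, Sym2.eq_swap])
        · exact (hT e).2 (by rw [hends, Sym2.eq_swap])
      -- then `b ∈ M₂(G − d)` by the closed edge from `a ∈ {r, s}`
      have hde : d ∉ ends e := notMem_of_ends_ne hends htd hbd
      have hbM : b ∈ M2 (endsD ends d) r s ω₀ := by
        have haM : a ∈ M2 (endsD ends d) r s ω₀ := by
          rcases ht with rfl | rfl
          · exact r_mem_M2 a s ω₀
          · exact s_mem_M2 r a ω₀
        exact mem_M2_of_closed haM he₀ (by rw [endsD_of_notMem hde, hends])
      exact hbrs (hB b hbM)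
    exact key
  · rintro rfl
    exact conn_refl _ _ _

/-- On the fibre the `W`-world of `{r, s}` in `G` is `{r, s}`. -/
lemma mem_M2_iff_on_unitFibre (hdr : d ≠ r) (hds : d ≠ s)
    (hrs : within ends ({r, s} : Set V) = ∅) (hT : ∀ e, ends e ≠ s(d, r) ∧ ends e ≠ s(d, s))
    (hB : ∀ x ∈ M2 (endsD ends d) r s ω₀, x = r ∨ x = s) {ω : Config E}
    (hω : ∀ e ∈ touches ends (cluster ends ω₀ d ∪ K2 (endsD ends d) r s ω₀ ∪
      M2 (endsD ends d) r s ω₀), ω e = ω₀ e) {x : V} :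
    x ∈ M2 ends r s ω ↔ x = r ∨ x = s := by
  rw [mem_M2_iff, ← mem_cluster, ← mem_cluster,
    cluster_compl_mark_eq_singleton hdr hds hrs hT hB hω (Or.inl rfl),
    cluster_compl_mark_eq_singleton hdr hds hrs hT hB hω (Or.inr rfl)]
  simp

/-- On the fibre `Sep` is that of `ω₀`. -/
lemma sep2_iff_on_unitFibre (hdr : d ≠ r) (hds : d ≠ s)
    (hrs : within ends ({r, s} : Set V) = ∅) (hT : ∀ e, ends e ≠ s(d, r) ∧ ends e ≠ s(d, s))
    (hB : ∀ x ∈ M2 (endsD ends d) r s ω₀, x = r ∨ x = s) {ω : Config E}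
    (hω : ∀ e ∈ touches ends (cluster ends ω₀ d ∪ K2 (endsD ends d) r s ω₀ ∪
      M2 (endsD ends d) r s ω₀), ω e = ω₀ e) :
    sep2 ends p q r s ω ↔ sep2 ends p q r s ω₀ := by
  have h0 : ∀ e ∈ touches ends (cluster ends ω₀ d ∪ K2 (endsD ends d) r s ω₀ ∪
      M2 (endsD ends d) r s ω₀), ω₀ e = ω₀ e := fun _ _ => rfl
  rw [sep2_iff, sep2_iff, K2_eq_on_unitFibre hdr hds hB hω,
    mem_M2_iff_on_unitFibre hdr hds hrs hT hB hω, mem_M2_iff_on_unitFibre hdr hds hrs hT hB hω,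
    mem_M2_iff_on_unitFibre hdr hds hrs hT hB h0, mem_M2_iff_on_unitFibre hdr hds hrs hT hB h0]

/-- On the fibre `DOne` holds: the `W`-world of `{r, s}` is `{r, s}`. -/
lemma DOne_on_unitFibre (hdr : d ≠ r) (hds : d ≠ s)
    (hrs : within ends ({r, s} : Set V) = ∅) (hT : ∀ e, ends e ≠ s(d, r) ∧ ends e ≠ s(d, s))
    (hB : ∀ x ∈ M2 (endsD ends d) r s ω₀, x = r ∨ x = s) {ω : Config E}
    (hω : ∀ e ∈ touches ends (cluster ends ω₀ d ∪ K2 (endsD ends d) r s ω₀ ∪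
      M2 (endsD ends d) r s ω₀), ω e = ω₀ e) :
    DOne ends r s d ω := by
  intro x hxr hxs _ _ hxM
  rcases (mem_M2_iff_on_unitFibre hdr hds hrs hT hB hω).1 hxM with h | h
  · exact hxr h
  · exact hxs h

/-- On the fibre `d ∉ M₂`. -/
lemma d_notMem_M2_on_unitFibre (hdr : d ≠ r) (hds : d ≠ s)
    (hrs : within ends ({r, s} : Set V) = ∅) (hT : ∀ e, ends e ≠ s(d, r) ∧ ends e ≠ s(d, s))
    (hB : ∀ x ∈ M2 (endsD ends d) r s ω₀, x = r ∨ x = s) {ω : Config E}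
    (hω : ∀ e ∈ touches ends (cluster ends ω₀ d ∪ K2 (endsD ends d) r s ω₀ ∪
      M2 (endsD ends d) r s ω₀), ω e = ω₀ e) :
    d ∉ M2 ends r s ω := by
  intro h
  rcases (mem_M2_iff_on_unitFibre hdr hds hrs hT hB hω).1 h with h | h
  · exact hdr h
  · exact hds h

/-- On the fibre `σ_rs` is that of `ω₀`. -/
lemma sigma_rs_eq_on_unitFibre (hdr : d ≠ r) (hds : d ≠ s)
    (hrs : within ends ({r, s} : Set V) = ∅) (hT : ∀ e, ends e ≠ s(d, r) ∧ ends e ≠ s(d, s))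
    (hB : ∀ x ∈ M2 (endsD ends d) r s ω₀, x = r ∨ x = s) {ω : Config E}
    (hω : ∀ e ∈ touches ends (cluster ends ω₀ d ∪ K2 (endsD ends d) r s ω₀ ∪
      M2 (endsD ends d) r s ω₀), ω e = ω₀ e) :
    sigma ends ω r s = sigma ends ω₀ r s := by
  have h0 : ∀ e ∈ touches ends (cluster ends ω₀ d ∪ K2 (endsD ends d) r s ω₀ ∪
      M2 (endsD ends d) r s ω₀), ω₀ e = ω₀ e := fun _ _ => rfl
  have hY : Conn ends ω r s ↔ Conn ends ω₀ r s := by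
    rw [← mem_cluster, ← mem_cluster,
      cluster_eq_on_unitFibre hdr hds hB hω (z := r) (Or.inl (Or.inr (r_mem_K2 r s ω₀)))]
  have hW : Conn ends (OneColourSwitch.compl ω) r s ↔
      Conn ends (OneColourSwitch.compl ω₀) r s := by
    rw [← mem_cluster, ← mem_cluster,
      cluster_compl_mark_eq_singleton hdr hds hrs hT hB hω (Or.inl rfl),
      cluster_compl_mark_eq_singleton hdr hds hrs hT hB h0 (Or.inl rfl)]
  simp only [sigma, hY, hW]

/-- `σ_rs ≥ 0` on a colouring without a `W`-side, no edge inside `{r, s}` and no `T`-edge. -/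
lemma sigma_rs_nonneg_of_noWside (hdr : d ≠ r) (hds : d ≠ s)
    (hrs : within ends ({r, s} : Set V) = ∅) (hT : ∀ e, ends e ≠ s(d, r) ∧ ends e ≠ s(d, s))
    (hB : ∀ x ∈ M2 (endsD ends d) r s ω₀, x = r ∨ x = s) :
    0 ≤ sigma ends ω₀ r s := by
  have h0 : ∀ e ∈ touches ends (cluster ends ω₀ d ∪ K2 (endsD ends d) r s ω₀ ∪
      M2 (endsD ends d) r s ω₀), ω₀ e = ω₀ e := fun _ _ => rfl
  have hW : Conn ends (OneColourSwitch.compl ω₀) r s ↔ s = r := by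
    rw [← mem_cluster, cluster_compl_mark_eq_singleton hdr hds hrs hT hB h0 (Or.inl rfl)]
    simp
  simp only [sigma]
  by_cases hsr : s = r
  · subst hsr
    rw [if_pos (conn_refl _ _ _), if_pos (conn_refl _ _ _)]
    norm_num
  · rw [if_neg (fun h => hsr (hW.1 h))]
    split_ifs <;> norm_num

/-- The representative of the fibre of `ω` — every free edge `W` — agrees with `ω` on the edges
touching `U(ω)`. -/
lemma rep_eqOn_touches_U (ω : Config E) :
    ∀ e ∈ touches ends (cluster ends ω d ∪ K2 (endsD ends d) r s ω ∪ M2 (endsD ends d) r s ω),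
      (fun e => if e ∈ touches ends (cluster ends ω d ∪ K2 (endsD ends d) r s ω ∪
        M2 (endsD ends d) r s ω) then ω e else false) e = ω e := by
  intro e he
  simp only [if_pos he]

/-- The fibre of a representative `ρ` (a colouring with every free edge `W`) is the set of
colourings with representative `ρ`. -/
lemma rep_eq_iff_mem_fibre (hdr : d ≠ r) (hds : d ≠ s) {ρ ω : Config E}
    (hB : ∀ x ∈ M2 (endsD ends d) r s ω, x = r ∨ x = s)
    (hρ : (fun e => if e ∈ touches ends (cluster ends ρ d ∪ K2 (endsD ends d) r s ρ ∪
      M2 (endsD ends d) r s ρ) then ρ e else false) = ρ) :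
    (fun e => if e ∈ touches ends (cluster ends ω d ∪ K2 (endsD ends d) r s ω ∪
      M2 (endsD ends d) r s ω) then ω e else false) = ρ ↔
      ∀ e ∈ touches ends (cluster ends ρ d ∪ K2 (endsD ends d) r s ρ ∪
        M2 (endsD ends d) r s ρ), ω e = ρ e := by
  constructor
  · intro h e he
    -- `ρ` lies in the fibre of `ω`, so `U(ρ) = U(ω)`
    have hρω : ∀ e ∈ touches ends (cluster ends ω d ∪ K2 (endsD ends d) r s ω ∪
        M2 (endsD ends d) r s ω), ρ e = ω e := by
      rw [← h]; exact rep_eqOn_touches_U ω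
    have hU := U_eq_on_unitFibre hdr hds hB hρω
    rw [hU] at he
    exact (hρω e he).symm
  · intro hω
    have hBρ : ∀ x ∈ M2 (endsD ends d) r s ρ, x = r ∨ x = s := by
      rw [← M2_endsD_eq_on_unitFibre hdr hds hω]; exact hB
    have hU := U_eq_on_unitFibre hdr hds hBρ hω
    rw [← hρ]
    funext e
    simp only [hU]
    by_cases he : e ∈ touches ends (cluster ends ρ d ∪ K2 (endsD ends d) r s ρ ∪
        M2 (endsD ends d) r s ρ)
    · rw [if_pos he, if_pos he, hω e he]
    · rw [if_neg he, if_neg he]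

/-- The representative map is idempotent. -/
lemma rep_rep (hdr : d ≠ r) (hds : d ≠ s) {ω : Config E}
    (hB : ∀ x ∈ M2 (endsD ends d) r s ω, x = r ∨ x = s) :
    (fun e => if e ∈ touches ends (cluster ends
      (fun e => if e ∈ touches ends (cluster ends ω d ∪ K2 (endsD ends d) r s ω ∪
        M2 (endsD ends d) r s ω) then ω e else false) d ∪
      K2 (endsD ends d) r s (fun e => if e ∈ touches ends (cluster ends ω d ∪
        K2 (endsD ends d) r s ω ∪ M2 (endsD ends d) r s ω) then ω e else false) ∪
      M2 (endsD ends d) r s (fun e => if e ∈ touches ends (cluster ends ω d ∪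
        K2 (endsD ends d) r s ω ∪ M2 (endsD ends d) r s ω) then ω e else false)) then
      (fun e => if e ∈ touches ends (cluster ends ω d ∪ K2 (endsD ends d) r s ω ∪
        M2 (endsD ends d) r s ω) then ω e else false) e else false) =
    (fun e => if e ∈ touches ends (cluster ends ω d ∪ K2 (endsD ends d) r s ω ∪
      M2 (endsD ends d) r s ω) then ω e else false) := by
  have hU := U_eq_on_unitFibre hdr hds hB (rep_eqOn_touches_U (r := r) (s := s) (d := d) ω)
  funext e
  simp only [hU]
  by_cases he : e ∈ touches ends (cluster ends ω d ∪ K2 (endsD ends d) r s ω ∪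
      M2 (endsD ends d) r s ω)
  · simp [he]
  · simp [he]

end Pointwise

section Sum

variable [Fintype E] [DecidableEq E] {ends : E → Sym2 V} {p q r s d : V}

/-- **The `K`-only points without a `W`-side, summed fibre by fibre**: for every predicate `P`
constant on the exploration fibres and every family `A` of lower sets constant on the fibres,
`Σ_{Sep ∧ DOne ∧ d ∈ K₂ ∖ M₂ ∧ no W-side ∧ P ω ∧ ω ∈ A ω} σ_pq · σ_rs ≤ 0`
(`proofs/P3-POCKETRK.md` §3 and §5‴ (c) in one statement). -/
theorem sum_konly_noWside_nonpos (hdr : d ≠ r) (hds : d ≠ s)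
    (hrs : within ends ({r, s} : Set V) = ∅) (hT : ∀ e, ends e ≠ s(d, r) ∧ ends e ≠ s(d, s))
    (P : Config E → Prop)
    (hP : ∀ ω ω' : Config E, (∀ x ∈ M2 (endsD ends d) r s ω, x = r ∨ x = s) →
      (∀ e ∈ touches ends (cluster ends ω d ∪ K2 (endsD ends d) r s ω ∪
        M2 (endsD ends d) r s ω), ω' e = ω e) → P ω → P ω')
    (A : Config E → Set (Config E)) (hA : ∀ ω, IsLowerSet (A ω))
    (hAf : ∀ ω ω' : Config E, (∀ x ∈ M2 (endsD ends d) r s ω, x = r ∨ x = s) →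
      (∀ e ∈ touches ends (cluster ends ω d ∪ K2 (endsD ends d) r s ω ∪
        M2 (endsD ends d) r s ω), ω' e = ω e) → A ω' = A ω) :
    (∑ ω : Config E, if sep2 ends p q r s ω ∧ DOne ends r s d ω ∧ d ∈ K2 ends r s ω ∧
        d ∉ M2 ends r s ω ∧ (∀ x ∈ M2 (endsD ends d) r s ω, x = r ∨ x = s) ∧ P ω ∧ ω ∈ A ω then
      sigma ends ω p q * sigma ends ω r s else 0) ≤ 0 := by
  -- the fibre-invariant part of the condition
  set c₀ : Config E → Prop := fun ω => sep2 ends p q r s ω ∧ DOne ends r s d ω ∧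
    d ∈ K2 ends r s ω ∧ d ∉ M2 ends r s ω ∧ (∀ x ∈ M2 (endsD ends d) r s ω, x = r ∨ x = s) ∧
    P ω with hc₀
  -- `c₀` is constant on the fibres
  have hinv : ∀ ω ω' : Config E, (∀ e ∈ touches ends (cluster ends ω d ∪
      K2 (endsD ends d) r s ω ∪ M2 (endsD ends d) r s ω), ω' e = ω e) → c₀ ω → c₀ ω' := by
    intro ω ω' hω' hω
    obtain ⟨hsep, _, hK, _, hB, hPω⟩ := hω
    refine ⟨(sep2_iff_on_unitFibre hdr hds hrs hT hB hω').2 hsep,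
      DOne_on_unitFibre hdr hds hrs hT hB hω', ?_, d_notMem_M2_on_unitFibre hdr hds hrs hT hB hω',
      M2_endsD_subset_on_unitFibre hdr hds hB hω', hP ω ω' hB hω' hPω⟩
    rw [K2_eq_on_unitFibre hdr hds hB hω']; exact hK
  -- the representative map
  set rep : Config E → Config E := fun ω => fun e => if e ∈ touches ends (cluster ends ω d ∪
    K2 (endsD ends d) r s ω ∪ M2 (endsD ends d) r s ω) then ω e else false with hrep
  set S₀ := univ.filter c₀ with hS₀
  set T := S₀.filter (fun ρ => rep ρ = ρ) with hT'
  have hmaps : ∀ ω ∈ S₀, rep ω ∈ T := by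
    intro ω hω
    rw [hS₀, Finset.mem_filter] at hω
    rw [hT', Finset.mem_filter, hS₀, Finset.mem_filter]
    refine ⟨⟨Finset.mem_univ _, hinv ω (rep ω) (rep_eqOn_touches_U ω) hω.2⟩, ?_⟩
    exact rep_rep hdr hds hω.2.2.2.2.2.1
  -- the sum as a sum over `S₀`, then fibre by fibre
  have hsum : (∑ ω : Config E, if c₀ ω ∧ ω ∈ A ω then
      sigma ends ω p q * sigma ends ω r s else 0) =
      ∑ ρ ∈ T, ∑ ω ∈ S₀.filter (fun ω => rep ω = ρ),
        if ω ∈ A ω then sigma ends ω p q * sigma ends ω r s else 0 := by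
    rw [Finset.sum_fiberwise_of_maps_to hmaps, hS₀, Finset.sum_filter]
    refine Finset.sum_congr rfl fun ω _ => ?_
    rw [ite_and]
  have hgoal : (∑ ω : Config E, if sep2 ends p q r s ω ∧ DOne ends r s d ω ∧
      d ∈ K2 ends r s ω ∧ d ∉ M2 ends r s ω ∧
      (∀ x ∈ M2 (endsD ends d) r s ω, x = r ∨ x = s) ∧ P ω ∧ ω ∈ A ω then
      sigma ends ω p q * sigma ends ω r s else 0) =
      ∑ ω : Config E, if c₀ ω ∧ ω ∈ A ω then sigma ends ω p q * sigma ends ω r s else 0 := by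
    refine Finset.sum_congr rfl fun ω _ => ?_
    simp only [hc₀, and_assoc]
  rw [hgoal, hsum]
  refine Finset.sum_nonpos fun ρ hρ => ?_
  rw [hT', Finset.mem_filter, hS₀, Finset.mem_filter] at hρ
  obtain ⟨⟨_, hρc⟩, hρrep⟩ := hρ
  have hsepρ := hρc.1
  have hBρ := hρc.2.2.2.2.1
  -- the fibre of `ρ`
  have hfib : S₀.filter (fun ω => rep ω = ρ) = univ.filter (fun ω : Config E =>
      ∀ e ∉ univ.filter (fun e => e ∉ touches ends (cluster ends ρ d ∪
        K2 (endsD ends d) r s ρ ∪ M2 (endsD ends d) r s ρ)), ω e = ρ e) := by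
    ext ω
    simp only [hS₀, Finset.mem_filter, Finset.mem_univ, true_and, not_not]
    constructor
    · rintro ⟨hω, hωρ⟩
      exact (rep_eq_iff_mem_fibre hdr hds hω.2.2.2.2.1 hρrep).1 hωρ
    · intro hω
      have hωc : c₀ ω := hinv ρ ω hω hρc
      exact ⟨hωc, (rep_eq_iff_mem_fibre hdr hds hωc.2.2.2.2.1 hρrep).2 hω⟩
  rw [hfib]
  -- on the fibre: `A ω = A ρ` and `σ_rs ω = σ_rs ρ`
  have hterm : ∀ ω ∈ univ.filter (fun ω : Config E =>
      ∀ e ∉ univ.filter (fun e => e ∉ touches ends (cluster ends ρ d ∪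
        K2 (endsD ends d) r s ρ ∪ M2 (endsD ends d) r s ρ)), ω e = ρ e),
      (if ω ∈ A ω then sigma ends ω p q * sigma ends ω r s else 0) =
        (if ω ∈ A ρ then sigma ends ω p q else 0) * sigma ends ρ r s := by
    intro ω hω
    have hω' : ∀ e ∈ touches ends (cluster ends ρ d ∪ K2 (endsD ends d) r s ρ ∪
        M2 (endsD ends d) r s ρ), ω e = ρ e := by
      intro e he
      simp only [Finset.mem_filter, Finset.mem_univ, true_and, not_not] at hω
      exact hω e he
    rw [hAf ρ ω hBρ hω', sigma_rs_eq_on_unitFibre hdr hds hrs hT hBρ hω']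
    split_ifs <;> simp
  rw [Finset.sum_congr rfl hterm, ← Finset.sum_mul]
  refine mul_nonpos_of_nonpos_of_nonneg ?_ (sigma_rs_nonneg_of_noWside hdr hds hrs hT hBρ)
  -- the fibre Harris: `p ∉ U(ρ)` by `Sep`
  have hp : p ∉ cluster ends ρ d ∪ K2 (endsD ends d) r s ρ ∪ M2 (endsD ends d) r s ρ := by
    have hpK := (not_mem_K2_of_sep2 hsepρ).1
    have hpM := (not_mem_M2_of_sep2 hsepρ).1
    rintro ((h | h) | h)
    · exact hpK (by
        rcases mem_K2_iff.1 hρc.2.2.1 with hc | hc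
        · exact mem_K2_iff.2 (Or.inl (conn_trans hc h))
        · exact mem_K2_iff.2 (Or.inr (conn_trans hc h)))
    · exact hpK (K2_endsD_subset_K2 ρ h)
    · exact hpM (M2_endsD_subset_M2 ρ h)
  exact sum_unitFibre_sigma_pq_of_isLowerSet_nonpos hdr hds hBρ hp (hA ρ)

end Sum

end NoPocket

end Summit.Ventures.PercRepro2
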